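import Summits.BirchSwinnertonDyer.BirchSwinnertonDyer.Theorems.SignedLowerHalvesSmallImageLowerHalfBothSignsRttCharRoadE2OfIsUnitNsub
import Summits.BirchSwinnertonDyer.BirchSwinnertonDyer.Theorems.SignedLowerHalvesSmallImageLowerHalfBothSignsRttD2SkeletonTransport
import HarnessLib

/-!
# Route `SignedLowerHalves`, crux L `SmallImageLowerHalfBothSigns` (stmt-BirchSwinnertonDyer-23599), line `rtt_w3` v14 — E2 (RULING «U»): THE v15 CONSUMER ON THE
# TWISTED SKELETON — `h52` for `θ*` replaced by `Thm52Shape` of the SOURCE skeleton `D₀` (finite-order `χ₀`, FACT `cor53_thm52ShapeO`) + the twist data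
# (a ring automorphism `σ = Tw_η` of `Λ_{𝒪,2}` and `σ`-semilinear equivalences of the carriers matching the zeta families = row «D-tw-coh»)

WHY (RULING «U» (HOME STATUS 2026-08-30T18:27:40Z), BRIEF-E2 rev 5 §4, HELPER-TABLE addendum 10; LEAD `cruxlead-stmt-BirchSwinnertonDyer-23599` g11). Under «U» the frame
skeleton `D` for `θ* = θ_ψ⁻¹` is the transport of honda's datum `D₀ = D(χ₀)` along `Tw_η`; the FACT gives `D₀.Thm52Shape` and the finiteness of `D₀`'s carriers,
and row «D-tw-alg» (p782462 `thm52Shape_of_semilinearEquiv`, `moduleFinite_of_semilinearEquiv`) transports both. THIS FILE composes that with the v15 consumer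
(p782277 `charRoad_E2_of_roadD_junction_of_isUnit_nsub`): ★★★★★★ `charRoad_E2_of_roadD_junction_of_twist` — hypotheses = glue data (G) · `D₀`, `h52₀` (source) ·
`σ`, `D`, `e₀ e₁ he₁ haZ e₂ he₂` (row «D-tw-coh», honda) · `b ∈ 𝔪`, `φ`-clauses, `hH1 : D.H1[f] = 0` (⟸ hTF), `a`/`ha` (rows 𝔞 ⟸ p781713 ∘ p782600 ∘ p782462's unit transfer),
pinned structures · junction `B s htB hcoker j₀ hexact hY` · `Col`, (an), `hCol[z := j₀ (s (zetaSp f D a))]`. So the v15 frame inputs are LITERALLY {honda's datum for χ₀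
+ FACT, the Tw-coh equivalences, `hH1`, the junction, Col/hCol}.

THEOREMS ONLY (`--supports stmt-BirchSwinnertonDyer-23599` helper); closes nothing; crux L, crux M, E2 and BSD remain OPEN and are proved for NO curve by any of this.
[cite: JohnsonLeungKings2011, Thm. 5.2, Cor. 5.3 (arXiv p0014:L114–138, p0015:L1–20)] [cite: Rubin2000, Ch. VI §1–§2 (twisting by characters of Γ)] [cite: Kobayashi2003, Thm. 7.3 i)]
[cite: GreenbergLNM1716, §1 p. 60]
-/

set_option autoImplicit false
-- the Theorems namespace of this sub repeats the summit name by design (D-0017 nested layout)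
set_option linter.dupNamespace false

noncomputable section
open scoped Pointwise Classical MatrixGroups ModularForm

open PowerSeries Literature.NumberTheory.Automorphic Literature.NumberTheory.EllipticCurves Literature.NumberTheory.EllipticCurves.Module
open Literature.NumberTheory.ComplexMultiplication.EllipticUnits.JohnsonLeungKings2011
open Summit.BirchSwinnertonDyer.BirchSwinnertonDyer.Theorems.SmallImageRttD2LamSpec
open Summit.BirchSwinnertonDyer.BirchSwinnertonDyer.Theorems.SmallImageRttD2Spec
open Literature.NumberTheory.IwasawaTheory Literature.NumberTheory.EllipticCurves.GreenbergVatsal2000 CongruenceSubgroup NumberField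
  IsDedekindDomain Rat.HeightOneSpectrum Literature.NumberTheory.EllipticCurves.ModularForms

namespace Summit.BirchSwinnertonDyer.BirchSwinnertonDyer.Theorems.SmallImageRttCharRoad

universe u v v₀ w w'

section E2

variable {p : ℕ} [Fact p.Prime] {S : Set (PadicAlgCl p)} [Algebra (IwasawaAlgebra p) (IwasawaAlgebraO S)]

set_option maxHeartbeats 400000 in -- same budget line as p780454/p782277
/-- ★★★★★★ **E2 from road D + the junction on the TWISTED skeleton.** p782277 with `h52 : D.Thm52Shape` and the finiteness of `D`'s carriers DISCHARGED from the
source skeleton `D₀` (`h52₀`, `Module.Finite`) and `σ`-semilinear equivalences `e₀, e₁, e₂` matching the zeta families (p782462). In E2 (RULING «U»):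
`D₀` = honda's datum for the finite-order `χ₀` (FACT `cor53_thm52ShapeO`, 𝔣 = 𝔪p^e), `σ = Tw_η`, `D` = the skeleton for `θ* = θ_ψ⁻¹`, `b = 0`.
[cite: JohnsonLeungKings2011, Thm. 5.2, Cor. 5.3] [cite: Rubin2000, Ch. VI §1–§2] [cite: Kobayashi2003, Thm. 7.3 i)] -/
theorem charRoad_E2_of_roadD_junction_of_twist [IsLocalRing (padicCoeffIntegers S)] (hS : 0 < Module.finrank ℚ_[p] (padicCoeffField S))
    (halg : ∀ r : IwasawaAlgebra p, algebraMap (IwasawaAlgebra p) (IwasawaAlgebraO S) r = iwasawaToIwasawaO S r)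
    {M : ℕ} [NeZero M] (g : CuspForm (Gamma0 M) 2) (ι : coeffField g →+* PadicAlgCl p) (hng : IsNewform0 g)
    (S₀ : Finset (HeightOneSpectrum (𝓞 ℚ)))
    {Q X' : Type} [AddCommGroup Q] [AddCommGroup X'] [Module (IwasawaAlgebraO S) Q] [Module (IwasawaAlgebra p) Q]
    [IsScalarTower (IwasawaAlgebra p) (IwasawaAlgebraO S) Q] [Module (IwasawaAlgebraO S) X'] [Module (IwasawaAlgebra p) X']
    [IsScalarTower (IwasawaAlgebra p) (IwasawaAlgebraO S) X'] [Module.Finite (IwasawaAlgebra p) X'] (hX' : Module.IsTorsion (IwasawaAlgebra p) X')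
    (gX : Q →ₗ[IwasawaAlgebraO S] X') (b : padicCoeffIntegers S)
    (hb : b ∈ IsLocalRing.maximalIdeal (padicCoeffIntegers S)) (φ : PowerSeries (IwasawaAlgebraO S) →+* IwasawaAlgebraO S)
    (hφf : φ (C (X - C b)) = 0) (hC : ∀ a : padicCoeffIntegers S, φ (C (C a)) = C a) (hX : φ X = X)
    (hker : RingHom.ker φ = Ideal.span {C (X - C b)})
    {Aidx H0 H1 H2 : Type v} [AddCommGroup H0]
    [Module (PowerSeries (IwasawaAlgebraO S)) H0] [AddCommGroup H1] [Module (PowerSeries (IwasawaAlgebraO S)) H1] [AddCommGroup H2]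
    [Module (PowerSeries (IwasawaAlgebraO S)) H2]
    -- the source skeleton `D₀` (honda's datum for the finite-order `χ₀`, FACT `cor53_thm52ShapeO`) and the twist `σ = Tw_η`
    {H0₀ H1₀ H2₀ : Type v₀} [AddCommGroup H0₀] [Module (PowerSeries (IwasawaAlgebraO S)) H0₀] [AddCommGroup H1₀]
    [Module (PowerSeries (IwasawaAlgebraO S)) H1₀] [AddCommGroup H2₀] [Module (PowerSeries (IwasawaAlgebraO S)) H2₀]
    [Module.Finite (PowerSeries (IwasawaAlgebraO S)) H1₀] [Module.Finite (PowerSeries (IwasawaAlgebraO S)) H2₀]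
    (D₀ : ZetaSkeleton (PowerSeries (IwasawaAlgebraO S)) Aidx H0₀ H1₀ H2₀) (h52₀ : D₀.Thm52Shape)
    (σ : PowerSeries (IwasawaAlgebraO S) ≃+* PowerSeries (IwasawaAlgebraO S))
    (D : ZetaSkeleton (PowerSeries (IwasawaAlgebraO S)) Aidx H0 H1 H2)
    (e₀ : H0₀ ≃+ H0) (e₁ : H1₀ ≃+ H1) (he₁ : ∀ (r : PowerSeries (IwasawaAlgebraO S)) (m : H1₀), e₁ (r • m) = σ r • e₁ m)
    (haZ : ∀ a : Aidx, e₁ (D₀.aZeta a) = D.aZeta a)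
    (e₂ : H2₀ ≃+ H2) (he₂ : ∀ (r : PowerSeries (IwasawaAlgebraO S)) (m : H2₀), e₂ (r • m) = σ r • e₂ m)
    (hH1 : Submodule.torsionBy (PowerSeries (IwasawaAlgebraO S)) H1 (C (X - C b)) = ⊥) (a : Aidx) (ha : IsUnit (φ (D.nsub a)))
    [Module (IwasawaAlgebraO S) (QuotSMulTop (C (X - C b) : PowerSeries (IwasawaAlgebraO S)) H1)]
    (hιH : ∀ (l : IwasawaAlgebraO S) (x : QuotSMulTop (C (X - C b) : PowerSeries (IwasawaAlgebraO S)) H1),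
      l • x = (PowerSeries.map (PowerSeries.C : padicCoeffIntegers S →+* IwasawaAlgebraO S) l) • x)
    [Module (IwasawaAlgebra p) (QuotSMulTop (C (X - C b) : PowerSeries (IwasawaAlgebraO S)) H1)]
    [IsScalarTower (IwasawaAlgebra p) (IwasawaAlgebraO S) (QuotSMulTop (C (X - C b) : PowerSeries (IwasawaAlgebraO S)) H1)]
    [Module (IwasawaAlgebra p) (Submodule.torsionBy (PowerSeries (IwasawaAlgebraO S)) H2 (C (X - C b)))]
    (hΛT : ∀ (r : IwasawaAlgebra p) (x : Submodule.torsionBy (PowerSeries (IwasawaAlgebraO S)) H2 (C (X - C b))),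
      r • x = (PowerSeries.map (PowerSeries.C : padicCoeffIntegers S →+* IwasawaAlgebraO S) (iwasawaToIwasawaO S r)) • x)
    [Module (IwasawaAlgebra p) (QuotSMulTop (C (X - C b) : PowerSeries (IwasawaAlgebraO S)) H2)]
    (hΛ2 : ∀ (r : IwasawaAlgebra p) (x : QuotSMulTop (C (X - C b) : PowerSeries (IwasawaAlgebraO S)) H2),
      r • x = (PowerSeries.map (PowerSeries.C : padicCoeffIntegers S →+* IwasawaAlgebraO S) (iwasawaToIwasawaO S r)) • x)
    {B : Type w} [AddCommGroup B] [Module (IwasawaAlgebraO S) B] [Module (IwasawaAlgebra p) B] [IsScalarTower (IwasawaAlgebra p) (IwasawaAlgebraO S) B]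
    (s : QuotSMulTop (C (X - C b) : PowerSeries (IwasawaAlgebraO S)) H1 →ₗ[IwasawaAlgebraO S] B)
    [Module.Finite (IwasawaAlgebra p) (B ⧸ LinearMap.range s)] (htB : Module.IsTorsion (IwasawaAlgebra p) (B ⧸ LinearMap.range s))
    (hcoker : lambdaInvariant p (B ⧸ LinearMap.range s) ≤ lambdaInvariant p (Submodule.torsionBy (PowerSeries (IwasawaAlgebraO S)) H2 (C (X - C b))))
    (j₀ : B →ₗ[IwasawaAlgebraO S] Q) (hexact : Function.Exact j₀ gX)
    (hY : lambdaInvariant p (QuotSMulTop (C (X - C b) : PowerSeries (IwasawaAlgebraO S)) H2) ≤ lambdaInvariant p (X' ⧸ LinearMap.range gX))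
    (Col : Q ≃ₗ[IwasawaAlgebraO S] IwasawaAlgebraO S) (L : IwasawaAlgebraO (Set.range ι)) (hL : L ≠ 0) {c : PadicAlgCl p} (hc : c ≠ 0)
    (fv : HeightOneSpectrum (𝓞 ℚ) → ℤ_[p]) (hfv : ∀ v ∈ S₀, fv v ≠ 0 ∧ (fv v).valuation = (frobeniusExponent p (natGenerator v : ℤ_[p])).valuation)
    (hCol : iwasawaOToPowerSeries S (Col (j₀ (s (zetaSp (C (X - C b) : PowerSeries (IwasawaAlgebraO S)) D a)))) =
      PowerSeries.C c * iwasawaOToPowerSeries (Set.range ι) L *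
        ∏ v ∈ S₀, Polynomial.aeval (PowerSeries.C ((natGenerator v : PadicAlgCl p)⁻¹) *
            (PowerSeries.binomialSeries ℤ_[p] (fv v)).map (algebraMap ℤ_[p] (PadicAlgCl p)))
          (1 - Polynomial.C (embCoeff g ι (natGenerator v)) * Polynomial.X +
            (if natGenerator v ∣ M then 0 else Polynomial.C (natGenerator v : PadicAlgCl p)) * Polynomial.X ^ 2)) :
    ∃ d : ℕ, (∀ k : ℕ, ‖PowerSeries.coeff k (iwasawaOToPowerSeries (Set.range ι) L)‖ ≤
        ‖PowerSeries.coeff d (iwasawaOToPowerSeries (Set.range ι) L)‖) ∧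
      (∀ k : ℕ, k < d → ‖PowerSeries.coeff k (iwasawaOToPowerSeries (Set.range ι) L)‖ <
        ‖PowerSeries.coeff d (iwasawaOToPowerSeries (Set.range ι) L)‖) ∧
      Module.finrank ℚ_[p] (padicCoeffField S) * (d + ∑ v ∈ S₀, p ^ (frobeniusExponent p (natGenerator v : ℤ_[p])).valuation *
        layerLambda ((1 - Polynomial.C (embCoeff g ι (natGenerator v)) * Polynomial.X +
          (if natGenerator v ∣ M then 0 else Polynomial.C (natGenerator v : PadicAlgCl p)) * Polynomial.X ^ 2).comp
            (Polynomial.C ((natGenerator v : PadicAlgCl p)⁻¹) * (Polynomial.X + 1)))) ≤ lambdaInvariant p X' := by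
  haveI : Module.Finite (PowerSeries (IwasawaAlgebraO S)) H1 := moduleFinite_of_semilinearEquiv σ e₁ he₁
  haveI : Module.Finite (PowerSeries (IwasawaAlgebraO S)) H2 := moduleFinite_of_semilinearEquiv σ e₂ he₂
  have h52 : D.Thm52Shape := thm52Shape_of_semilinearEquiv σ D₀ D e₁ he₁ haZ e₀ e₂ he₂ h52₀
  exact charRoad_E2_of_roadD_junction_of_isUnit_nsub hS halg g ι hng S₀ hX' gX b hb φ hφf hC hX hker D h52 hH1 a ha hιH hΛT hΛ2
    s htB hcoker j₀ hexact hY Col L hL hc fv hfv hCol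

end E2

end Summit.BirchSwinnertonDyer.BirchSwinnertonDyer.Theorems.SmallImageRttCharRoad

end
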